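import Literature.AnabelianGeometry.EtaleTheta.ThetaSystems

/-!
# [EtTh] §2 discharge toolkit: conjugates of a theta cocycle by the POWERS of one element
# (the cocycle algebra behind the bi-theta symmetry clause of Prop 2.14 (iii) / Cor 2.16)

Mochizuki, *The Étale Theta Function and its Frobenioid-theoretic Manifestations* [EtTh],
Publ. RIMS 45 (2009), §2, Prop 2.14 (iii) p.50 and Cor 2.16 pp.53–54 (locators `p.N` = PDF pages of
the PRIMS text; bib key `MochizukiEtTh2009`). PROOF-ONLY companion (no `def`; seat abc-iut-L2-t2, DAG
node `EtTh:Cor2.16`) of `ThetaSystems.lean` (`ThetaEnvTower.conjCocycle`, `ThetaEnvTower.Cor216`).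

`Discharge/Sec2NondiscretenessGenProofs.lean` (`ThetaEnvTower.cor216_of_generator_aux`) reduced the named
fact `Cor216` to ONE input: for a generator `x` of `Gal(Y/X)` with `aug x = 1`, conjugation by `x^a`,
`M ∣ a`, carries every mod-`M` theta cocycle `η` to `η` times a coboundary. This file proves the GENERIC
cocycle algebra that yields exactly this input from "second-difference" data of the `⟨x⟩`-orbit of `η`
(pure group theory over the interface `ThetaEnvTower`, no model):

* the action laws of `conjCocycle` (`conjCocycle_one_left`, `conjCocycle_mul_left`, multiplicativity in
  the function, transport of coboundaries `conjCocycle_coboundary`);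
* `ThetaEnvTower.conjCocycle_pow_eq_mul_coboundary_of_secondDiff` /
  `…_zpow_…`: writing `ψ := (x·η)·η⁻¹` and `ν := (x·ψ)·ψ⁻¹` (the first and second "differences" of the
  orbit), IF `ν` is a SQUARE `ν'²` and is FIXED by `x`, both modulo coboundaries, THEN
  `(x^a·η) = η · ∂c` for every `a ∈ ℤ` with `M ∣ a` — because, modulo coboundaries,
  `(x^n·η)·η⁻¹ ≡ ψ^n · ν^{n(n−1)/2}`, `ψ^M = 1` (`μ_M` has exponent `M`) and `ν^{n(n−1)/2} ≡ ν'^{n(n−1)}`.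

The parity hypothesis (`ν` a square) is where the oddness of `l` enters for the §1 model
(`Discharge/Sec2Cor216OfModel.lean`): there `ν` is an `l·Δ_Θ`-valued lift of a `(2l)`-th power class, and
the lift ambiguity is the Kummer class of an element of `μ_l`, a square since `l` is odd. HONEST FRAMING:
conditional algebra only; no side is taken on [IUTchIII] Cor 3.12; typed ≠ discharged elsewhere.
-/

noncomputable section

namespace Literature.AnabelianGeometry.EtaleTheta

universe u

/-! ## Coboundaries form a subgroup stable under the character -/

namespace CycEnvelope

variable {P G μ : Type*} [Group P] [Group G] [CommGroup μ] (aug : P →* G) (χ : G →* MulAut μ)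

/-- `∂1 = 1`. [cite: MochizukiEtTh2009, Prop 2.14(ii) p.47] -/
theorem coboundary_one : coboundary aug χ (1 : μ) = 1 := by
  funext g; simp [coboundary]

/-- `∂(c·c') = ∂c · ∂c'` (`μ_N` commutative). [cite: MochizukiEtTh2009, Prop 2.14(ii) p.47] -/
theorem coboundary_mul (c c' : μ) :
    coboundary aug χ (c * c') = coboundary aug χ c * coboundary aug χ c' := by
  funext g
  simp only [coboundary, Pi.mul_apply, map_mul, mul_inv]
  rw [mul_mul_mul_comm]

/-- `∂(c⁻¹) = (∂c)⁻¹`. [cite: MochizukiEtTh2009, Prop 2.14(ii) p.47] -/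
theorem coboundary_inv (c : μ) : coboundary aug χ c⁻¹ = (coboundary aug χ c)⁻¹ := by
  funext g
  simp only [coboundary, Pi.inv_apply, map_inv, mul_inv, inv_inv]

/-- `∂(c^n) = (∂c)^n`. [cite: MochizukiEtTh2009, Prop 2.14(ii) p.47] -/
theorem coboundary_pow (c : μ) (n : ℕ) : coboundary aug χ (c ^ n) = coboundary aug χ c ^ n := by
  induction n with
  | zero => rw [pow_zero, pow_zero, coboundary_one]
  | succ n ih => rw [pow_succ, pow_succ, coboundary_mul, ih]

end CycEnvelope

namespace ThetaEnvTower

variable {E : Set ℕ+} (T : ThetaEnvTower.{u} E)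

/-! ## Action laws of `conjCocycle` -/

/-- `conjCocycle` evaluated (definition). [cite: MochizukiEtTh2009, Cor 2.16 p.54] -/
theorem conjCocycle_apply (M : E) (x : T.PiX) (η : T.PiYdd → T.mu M) (g : T.PiYdd) :
    T.conjCocycle M x η g = T.chi M (T.aug x) (η ⟨x⁻¹ * g * x, by
      simpa [mul_assoc] using T.PiYdd_normal.conj_mem _ g.2 x⁻¹⟩) := rfl

/-- Conjugating by `1` does nothing. [cite: MochizukiEtTh2009, Cor 2.16 p.54] -/
theorem conjCocycle_one_left (M : E) (η : T.PiYdd → T.mu M) : T.conjCocycle M 1 η = η := by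
  funext g
  rw [conjCocycle_apply, map_one, map_one, MulAut.one_apply]
  congr 1
  apply Subtype.ext
  simp

/-- `((xy)·η) = x·(y·η)`. [cite: MochizukiEtTh2009, Cor 2.16 p.54] -/
theorem conjCocycle_mul_left (M : E) (x y : T.PiX) (η : T.PiYdd → T.mu M) :
    T.conjCocycle M (x * y) η = T.conjCocycle M x (T.conjCocycle M y η) := by
  funext g
  simp only [conjCocycle_apply, map_mul, MulAut.mul_apply]
  congr 2
  exact congrArg η (Subtype.ext (by simp only [mul_inv_rev, mul_assoc]))

/-- `x·(η·η') = (x·η)·(x·η')`. [cite: MochizukiEtTh2009, Cor 2.16 p.54] -/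
theorem conjCocycle_mul_right (M : E) (x : T.PiX) (η η' : T.PiYdd → T.mu M) :
    T.conjCocycle M x (η * η') = T.conjCocycle M x η * T.conjCocycle M x η' := by
  funext g
  simp only [conjCocycle_apply, Pi.mul_apply, map_mul]

/-- `x·η⁻¹ = (x·η)⁻¹`. [cite: MochizukiEtTh2009, Cor 2.16 p.54] -/
theorem conjCocycle_inv_right (M : E) (x : T.PiX) (η : T.PiYdd → T.mu M) :
    T.conjCocycle M x η⁻¹ = (T.conjCocycle M x η)⁻¹ := by
  funext g
  simp only [conjCocycle_apply, Pi.inv_apply, map_inv]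

/-- `x·(η^n) = (x·η)^n`. [cite: MochizukiEtTh2009, Cor 2.16 p.54] -/
theorem conjCocycle_pow_right (M : E) (x : T.PiX) (η : T.PiYdd → T.mu M) (n : ℕ) :
    T.conjCocycle M x (η ^ n) = T.conjCocycle M x η ^ n := by
  funext g
  simp only [conjCocycle_apply, Pi.pow_apply, map_pow]

/-- `x·1 = 1`. [cite: MochizukiEtTh2009, Cor 2.16 p.54] -/
theorem conjCocycle_one_right (M : E) (x : T.PiX) :
    T.conjCocycle M x (1 : T.PiYdd → T.mu M) = 1 := by
  funext g
  simp only [conjCocycle_apply, Pi.one_apply, map_one]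

/-- Conjugation transports coboundaries to coboundaries: `x·∂c = ∂(χ(aug x) c)`.
[cite: MochizukiEtTh2009, Prop 2.14(ii) p.47] -/
theorem conjCocycle_coboundary (M : E) (x : T.PiX) (c : T.mu M) :
    T.conjCocycle M x (CycEnvelope.coboundary (T.aug.comp T.PiYdd.subtype) (T.chi M) c) =
      CycEnvelope.coboundary (T.aug.comp T.PiYdd.subtype) (T.chi M) (T.chi M (T.aug x) c) := by
  funext g
  simp only [conjCocycle_apply, CycEnvelope.coboundary, MonoidHom.coe_comp, Function.comp_apply,
    Subgroup.coe_subtype, map_mul, map_inv, MulAut.mul_apply]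
  congr 2
  rw [← MulAut.mul_apply, ← MulAut.mul_apply, mul_inv_cancel, one_mul]

/-- Every `μ_M`-valued function is killed by `M` (`|μ_M| = M`). [cite: MochizukiEtTh2009, Def 2.10 p.44] -/
theorem fun_pow_card_eq_one (M : E) (η : T.PiYdd → T.mu M) : η ^ ((M : ℕ+) : ℕ) = 1 := by
  funext g
  rw [Pi.pow_apply, Pi.one_apply, ← T.card_mu M, pow_card_eq_one]

/-! ## The "equal modulo a coboundary" bookkeeping (as explicit `∃ c` statements) -/

section EqMod

variable (M : E)

/-- Reflexivity: `η = η · ∂1`. [cite: MochizukiEtTh2009, Prop 2.14(ii) p.47] -/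
theorem exists_eq_mul_coboundary_refl (η : T.PiYdd → T.mu M) :
    ∃ c : T.mu M, η = η * CycEnvelope.coboundary (T.aug.comp T.PiYdd.subtype) (T.chi M) c :=
  ⟨1, by rw [CycEnvelope.coboundary_one, mul_one]⟩

/-- Symmetry. [cite: MochizukiEtTh2009, Prop 2.14(ii) p.47] -/
theorem exists_eq_mul_coboundary_symm {η η' : T.PiYdd → T.mu M}
    (h : ∃ c : T.mu M, η = η' * CycEnvelope.coboundary (T.aug.comp T.PiYdd.subtype) (T.chi M) c) :
    ∃ c : T.mu M, η' = η * CycEnvelope.coboundary (T.aug.comp T.PiYdd.subtype) (T.chi M) c := by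
  obtain ⟨c, hc⟩ := h
  exact ⟨c⁻¹, by rw [hc, CycEnvelope.coboundary_inv, mul_inv_cancel_right]⟩

/-- Transitivity. [cite: MochizukiEtTh2009, Prop 2.14(ii) p.47] -/
theorem exists_eq_mul_coboundary_trans {η η' η'' : T.PiYdd → T.mu M}
    (h : ∃ c : T.mu M, η = η' * CycEnvelope.coboundary (T.aug.comp T.PiYdd.subtype) (T.chi M) c)
    (h' : ∃ c : T.mu M, η' = η'' * CycEnvelope.coboundary (T.aug.comp T.PiYdd.subtype) (T.chi M) c) :
    ∃ c : T.mu M, η = η'' * CycEnvelope.coboundary (T.aug.comp T.PiYdd.subtype) (T.chi M) c := by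
  obtain ⟨c, hc⟩ := h
  obtain ⟨c', hc'⟩ := h'
  exact ⟨c' * c, by rw [hc, hc', CycEnvelope.coboundary_mul, mul_assoc]⟩

/-- Compatibility with products. [cite: MochizukiEtTh2009, Prop 2.14(ii) p.47] -/
theorem exists_eq_mul_coboundary_mul {η₁ η₁' η₂ η₂' : T.PiYdd → T.mu M}
    (h₁ : ∃ c : T.mu M, η₁ = η₁' * CycEnvelope.coboundary (T.aug.comp T.PiYdd.subtype) (T.chi M) c)
    (h₂ : ∃ c : T.mu M, η₂ = η₂' * CycEnvelope.coboundary (T.aug.comp T.PiYdd.subtype) (T.chi M) c) :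
    ∃ c : T.mu M, η₁ * η₂ =
      η₁' * η₂' * CycEnvelope.coboundary (T.aug.comp T.PiYdd.subtype) (T.chi M) c := by
  obtain ⟨c, hc⟩ := h₁
  obtain ⟨c', hc'⟩ := h₂
  refine ⟨c * c', ?_⟩
  rw [hc, hc', CycEnvelope.coboundary_mul]
  simp only [mul_assoc, mul_left_comm]

/-- Compatibility with powers. [cite: MochizukiEtTh2009, Prop 2.14(ii) p.47] -/
theorem exists_eq_mul_coboundary_pow {η η' : T.PiYdd → T.mu M}
    (h : ∃ c : T.mu M, η = η' * CycEnvelope.coboundary (T.aug.comp T.PiYdd.subtype) (T.chi M) c)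
    (n : ℕ) :
    ∃ c : T.mu M, η ^ n = η' ^ n * CycEnvelope.coboundary (T.aug.comp T.PiYdd.subtype) (T.chi M) c := by
  obtain ⟨c, hc⟩ := h
  exact ⟨c ^ n, by rw [hc, mul_pow, CycEnvelope.coboundary_pow]⟩

/-- Compatibility with conjugation. [cite: MochizukiEtTh2009, Prop 2.14(ii) p.47] -/
theorem exists_eq_mul_coboundary_conj (x : T.PiX) {η η' : T.PiYdd → T.mu M}
    (h : ∃ c : T.mu M, η = η' * CycEnvelope.coboundary (T.aug.comp T.PiYdd.subtype) (T.chi M) c) :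
    ∃ c : T.mu M, T.conjCocycle M x η =
      T.conjCocycle M x η' * CycEnvelope.coboundary (T.aug.comp T.PiYdd.subtype) (T.chi M) c := by
  obtain ⟨c, hc⟩ := h
  exact ⟨T.chi M (T.aug x) c, by rw [hc, conjCocycle_mul_right, conjCocycle_coboundary]⟩

/-- A function killed by `M`-th powers is a coboundary modulo … itself: `η^(M·k) = 1 · ∂1`.
[cite: MochizukiEtTh2009, Def 2.10 p.44] -/
theorem exists_pow_mul_card_eq_coboundary (η : T.PiYdd → T.mu M) (k : ℕ) :
    ∃ c : T.mu M, η ^ (((M : ℕ+) : ℕ) * k) =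
      1 * CycEnvelope.coboundary (T.aug.comp T.PiYdd.subtype) (T.chi M) c :=
  ⟨1, by rw [pow_mul, fun_pow_card_eq_one, one_pow, CycEnvelope.coboundary_one, mul_one]⟩

end EqMod

/-! ## Conjugation by powers -/

/-- **The orbit of `η` under the powers of `x`, modulo coboundaries**: with `ψ := (x·η)·η⁻¹` and
`ν := (x·ψ)·ψ⁻¹`, if `x·ν ≡ ν` then `(x^n·η)·η⁻¹ ≡ ψ^n · ν^{n(n−1)/2}` for all `n ≥ 0` (the exponent
`n(n−1)/2 = n.choose 2`). [cite: MochizukiEtTh2009, Cor 2.16 p.54] -/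
theorem exists_conjCocycle_pow_eq (M : E) (x : T.PiX) (η ν : T.PiYdd → T.mu M)
    (h1 : ∃ c : T.mu M, T.conjCocycle M x (T.conjCocycle M x η * η⁻¹) =
      T.conjCocycle M x η * η⁻¹ * ν * CycEnvelope.coboundary (T.aug.comp T.PiYdd.subtype) (T.chi M) c)
    (h3 : ∃ c : T.mu M, T.conjCocycle M x ν =
      ν * CycEnvelope.coboundary (T.aug.comp T.PiYdd.subtype) (T.chi M) c)
    (n : ℕ) :
    ∃ c : T.mu M, T.conjCocycle M (x ^ n) η * η⁻¹ =
      (T.conjCocycle M x η * η⁻¹) ^ n * ν ^ (n.choose 2) *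
        CycEnvelope.coboundary (T.aug.comp T.PiYdd.subtype) (T.chi M) c := by
  set ψ := T.conjCocycle M x η * η⁻¹ with hψ
  -- `x^i · ν ≡ ν`, hence `x · ν^j ≡ ν^j`
  have hνpow : ∀ j : ℕ, ∃ c : T.mu M, T.conjCocycle M x (ν ^ j) =
      ν ^ j * CycEnvelope.coboundary (T.aug.comp T.PiYdd.subtype) (T.chi M) c := fun j => by
    rw [conjCocycle_pow_right]
    exact T.exists_eq_mul_coboundary_pow M h3 j
  -- `x · ψ^i ≡ (ψ ν)^i`
  have hψpow : ∀ i : ℕ, ∃ c : T.mu M, T.conjCocycle M x (ψ ^ i) =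
      (ψ * ν) ^ i * CycEnvelope.coboundary (T.aug.comp T.PiYdd.subtype) (T.chi M) c := fun i => by
    rw [conjCocycle_pow_right]
    exact T.exists_eq_mul_coboundary_pow M h1 i
  induction n with
  | zero =>
    refine ⟨1, ?_⟩
    rw [pow_zero, conjCocycle_one_left, mul_inv_cancel, pow_zero, Nat.choose_zero_succ, pow_zero,
      CycEnvelope.coboundary_one, mul_one, mul_one]
  | succ n ih =>
    -- `(x^{n+1}·η)·η⁻¹ = x·((x^n·η)·η⁻¹) · ψ`
    have hstep : T.conjCocycle M (x ^ (n + 1)) η * η⁻¹ =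
        T.conjCocycle M x (T.conjCocycle M (x ^ n) η * η⁻¹) * ψ := by
      rw [pow_succ', conjCocycle_mul_left, conjCocycle_mul_right, conjCocycle_inv_right, hψ]
      simp only [mul_assoc, inv_mul_cancel_left]
    rw [hstep]
    -- transport `ih` through `x·` and unfold the orbit relations
    obtain ⟨c₁, hc₁⟩ := T.exists_eq_mul_coboundary_conj M x ih
    obtain ⟨c₂, hc₂⟩ := hψpow n
    obtain ⟨c₃, hc₃⟩ := hνpow (n.choose 2)
    refine ⟨c₂ * c₃ * c₁, ?_⟩
    rw [hc₁, conjCocycle_mul_right, hc₂, hc₃, Nat.choose_succ_succ', Nat.choose_one_right,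
      CycEnvelope.coboundary_mul, CycEnvelope.coboundary_mul, mul_pow, pow_succ, pow_add]
    -- the target algebra: `(ψν)^n ν^{C(n,2)} ψ = ψ^{n+1} ν^{C(n+1,2)}` (commutative group of functions)
    simp only [mul_assoc, mul_comm, mul_left_comm]

/-- **Conjugation by the `M`-divisible powers of one element** (the cocycle algebra behind the bi-theta
clause of Prop 2.14 (iii) / Cor 2.16 for `N·(l·ℤ)`-conjugates): with `ψ := (x·η)·η⁻¹`, `ν := (x·ψ)·ψ⁻¹`, if
`ν ≡ ν'²` and `x·ν ≡ ν` modulo coboundaries, then `x^n·η ≡ η` for every `n ≥ 0` with `M ∣ n`.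
[cite: MochizukiEtTh2009, Prop 2.14(iii) p.50] -/
theorem conjCocycle_pow_eq_mul_coboundary_of_secondDiff (M : E) (x : T.PiX)
    (η ν ν' : T.PiYdd → T.mu M)
    (h1 : ∃ c : T.mu M, T.conjCocycle M x (T.conjCocycle M x η * η⁻¹) =
      T.conjCocycle M x η * η⁻¹ * ν * CycEnvelope.coboundary (T.aug.comp T.PiYdd.subtype) (T.chi M) c)
    (h2 : ∃ c : T.mu M, ν = ν' ^ 2 * CycEnvelope.coboundary (T.aug.comp T.PiYdd.subtype) (T.chi M) c)
    (h3 : ∃ c : T.mu M, T.conjCocycle M x ν =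
      ν * CycEnvelope.coboundary (T.aug.comp T.PiYdd.subtype) (T.chi M) c)
    (n : ℕ) (hn : ((M : ℕ+) : ℕ) ∣ n) :
    ∃ c : T.mu M, T.conjCocycle M (x ^ n) η =
      η * CycEnvelope.coboundary (T.aug.comp T.PiYdd.subtype) (T.chi M) c := by
  obtain ⟨k, rfl⟩ := hn
  have horbit := T.exists_conjCocycle_pow_eq M x η ν h1 h3 ((M : ℕ+) * k)
  -- `ψ^{Mk} ≡ 1`
  have hψ := T.exists_pow_mul_card_eq_coboundary M (T.conjCocycle M x η * η⁻¹) k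
  -- `ν^{C(Mk,2)} ≡ ν'^{2 C(Mk,2)} = ν'^{Mk(Mk-1)} ≡ 1`
  have hν : ∃ c : T.mu M, ν ^ (((M : ℕ+) : ℕ) * k).choose 2 =
      1 * CycEnvelope.coboundary (T.aug.comp T.PiYdd.subtype) (T.chi M) c := by
    have h := T.exists_eq_mul_coboundary_pow M h2 ((((M : ℕ+) : ℕ) * k).choose 2)
    refine T.exists_eq_mul_coboundary_trans M h ?_
    rw [← pow_mul, Nat.choose_two_right, Nat.mul_div_cancel' (Nat.even_mul_pred_self _).two_dvd,
      mul_assoc]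
    exact T.exists_pow_mul_card_eq_coboundary M ν' _
  have hprod := T.exists_eq_mul_coboundary_mul M hψ hν
  rw [one_mul] at hprod
  have key := T.exists_eq_mul_coboundary_trans M horbit hprod
  obtain ⟨c, hc⟩ := key
  refine ⟨c, ?_⟩
  rw [one_mul, mul_inv_eq_iff_eq_mul] at hc
  rw [hc, mul_comm]

/-- The same for all INTEGER powers `x^a`, `M ∣ a` (negative powers by transporting back).
[cite: MochizukiEtTh2009, Prop 2.14(iii) p.50] -/
theorem conjCocycle_zpow_eq_mul_coboundary_of_secondDiff (M : E) (x : T.PiX)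
    (η ν ν' : T.PiYdd → T.mu M)
    (h1 : ∃ c : T.mu M, T.conjCocycle M x (T.conjCocycle M x η * η⁻¹) =
      T.conjCocycle M x η * η⁻¹ * ν * CycEnvelope.coboundary (T.aug.comp T.PiYdd.subtype) (T.chi M) c)
    (h2 : ∃ c : T.mu M, ν = ν' ^ 2 * CycEnvelope.coboundary (T.aug.comp T.PiYdd.subtype) (T.chi M) c)
    (h3 : ∃ c : T.mu M, T.conjCocycle M x ν =
      ν * CycEnvelope.coboundary (T.aug.comp T.PiYdd.subtype) (T.chi M) c)
    (a : ℤ) (ha : (((M : ℕ+) : ℕ) : ℤ) ∣ a) :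
    ∃ c : T.mu M, T.conjCocycle M (x ^ a) η =
      η * CycEnvelope.coboundary (T.aug.comp T.PiYdd.subtype) (T.chi M) c := by
  have hnat : ((M : ℕ+) : ℕ) ∣ a.natAbs := Int.natCast_dvd.mp ha
  have hpos := T.conjCocycle_pow_eq_mul_coboundary_of_secondDiff M x η ν ν' h1 h2 h3 a.natAbs hnat
  rcases Int.natAbs_eq a with h | h
  · rw [h, zpow_natCast]
    exact hpos
  · -- `a = -|a|`: transport `x^{|a|}·η = η·∂c` back along `x^{-|a|}`
    obtain ⟨c, hc⟩ := hpos
    have h0 : a + (a.natAbs : ℤ) = 0 := by omega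
    have hxa : x ^ a * x ^ a.natAbs = 1 := by
      rw [← zpow_natCast, ← zpow_add, h0, zpow_zero]
    have hinv : T.conjCocycle M (x ^ a) (T.conjCocycle M (x ^ a.natAbs) η) = η := by
      rw [← conjCocycle_mul_left, hxa, conjCocycle_one_left]
    rw [hc, conjCocycle_mul_right, conjCocycle_coboundary] at hinv
    refine ⟨(T.chi M (T.aug (x ^ a)) c)⁻¹, ?_⟩
    rw [CycEnvelope.coboundary_inv, eq_mul_inv_iff_mul_eq, hinv]

end ThetaEnvTower

end Literature.AnabelianGeometry.EtaleTheta

end
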